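/-
Copyright (c) 2026 the pub-hodgecm-mathlib formalisation cell (harness21).  Prover seat hodgecm-mathlib-F0P3-p01 (g31), «(D-RAM) FOUR-FRAME» road of crux H413, line LH4, MS ROAD A,
STAGE B ∕ B56₂ (G-socket₂ assembly, dealer WORD #26 (2)), FILE S: THE BINDER-FREE SOCKET `stub_B56_G1` OF SKELETON₂ v2 — `hmult` of ★ FILE M discharged by LH4-p08 (g3)'s ★ counts.
2026-09-04.
-/
import Summits.HodgeConjecture.HodgeConjecture.Theorems.F0P3cDyRamDiagonalGluedSocketTwo                       -- ★ p856489 FILE M (this seat): the socket modulo `hmult`; brings ★ W, ★ F1₂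
import Summits.HodgeConjecture.HodgeConjecture.Theorems.F0P3cDyRamDiagonalGluedPolarisationCountTypeTwo        -- ★ p856515 G2-B (LH4-p08 (g3)): `polarisationCount_latt_glued_typeTwo_eq_pow`
import Summits.HodgeConjecture.HodgeConjecture.Theorems.F0P3cDyRamDiagonalGluedZeroPolarisationCountTypeTwo    -- ★ p856550 G2-C2 (LH4-p08 (g3)): `polarisationCount_latt_glued_zero_typeTwo_eq` (ρ = 0, `q − 1`)
import HarnessLib

/-!
# Crux `H413`, MS ROAD A, STAGE B ∕ B56₂, FILE S: `stub_B56_G1` of `B10-StableCountTypeTwo.SKELETON` v2 (reading (iii)) — binder for binder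

Cell `hodgecm-mathlib` (D-0151), FLOOR 0, crux item H413 = `stmt-HodgeConjecture-24833`; lane `--supports stmt-HodgeConjecture-24833 --as helper` (count-neutral).  THEOREMS ONLY
(no `def`, no instance, no notation, no `sorry`).  ★ FILE M `finsum_polarisationCount_mul_stabiliserWeight_stratumTwo_G1_of_mult` proved the re-keyed socket from ONE binder
`hmult : ∀ M ∈ stratumTwo σ ϖ T (2ρ+1, 2ρ+1+s, 2ρ+1+s), n₂(M) = (ρ = 0 ? q − 1 : q^{1−ρ%2})`; here `hmult` is DISCHARGED: for `ρ ≥ 1` by ★ F1₂ `stratumTwo_G1_eq` (the member is a glued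
frame lattice, polarisable) + ★ p856270 (polarisable ⟹ (R): a fixed `f₀` with `|ζσy″ − σx·f₀| ≤ |ϖ|^{ρ+s}`) + ★ G2-B `polarisationCount_latt_glued_typeTwo_eq_pow` (LH4-p08 (g3): the classes are
`(F ∩ 𝔭^{ρ+s}) ∕ (F ∩ 𝔭^{ρ+s+1})`, of order `q^{1−ρ%2}`); for `ρ = 0` by ★ F1₂ `stratumTwo_G1_zero_eq` + ★ G2-C2 (LH4-p08 (g3): `q − 1` classes `𝒪_F^× ∕ (1 + 𝔭_F)`).
HEAD **`finsum_polarisationCount_mul_stabiliserWeight_stratumTwo_G1`** — binders `(hD) (h2) (hE) (hN₀) (hT) (ρ s : ℕ) (hs : 1 ≤ s)` and conclusion of skeleton₂ 08e5e6e2 :81 VERBATIM with the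
re-keyed weight `(polarisationCount σ ϖ 2 M : ℚ) * stabiliserWeight σ M` (LH4-p10 (g2) 01:00:57Z, LH4-p11 (g2) 01:03:12Z), so B10₂-MULT pastes
`theorem stub_B56_G1 … := finsum_polarisationCount_mul_stabiliserWeight_stratumTwo_G1 hD h2 hE hN₀ hT ρ s hs` and §P₂ (LH4-p13 (g2)) transports it to the G₂ ∕ G₃ rotations.
HONEST LABEL.  Count-neutral (`--supports`); the census laws (MS) stay PROVER TARGETS until B10₂-MULT and (MS-B₂) close; `HC_CM` is proved only modulo the 7 printed citations
(2 remaining named inputs: hLiu418 = `stmt-HodgeConjecture-24832`, h413 = `stmt-HodgeConjecture-24833`) until rung 0 closes.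

## References
* [Kottwitz1986BaseChangeUnits] R. E. Kottwitz, *Base change for unit elements of Hecke algebras*, Compositio Math. 60 (1986), §1 pp. 240–241 (fixed-lattice counts via torus orbits).
* [Rogawski1990] J. D. Rogawski, *Automorphic Representations of Unitary Groups in Three Variables*, Ann. of Math. Stud. 123 (1990), §4.9 Prop. 4.9.1 (a) p. 55.
* [Jacobowitz1962] R. Jacobowitz, *Hermitian forms over local fields*, Amer. J. Math. 84 (1962), §7–§8 (`𝔭`-modular lattices).
-/

set_option autoImplicit false

noncomputable section

namespace Summit.HodgeConjecture.HodgeConjecture.Cruxes.H413.F0P3cDyRamDiagonalGluedSocketTwoStub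

open Matrix
open Literature.NumberTheory.Automorphic Literature.NumberTheory.Automorphic.HermitianLattice
open Literature.NumberTheory.Automorphic.UnitaryLatticeTree Literature.NumberTheory.Automorphic.UnitaryThreeFourFrame
open Literature.NumberTheory.LocalFields.WildQuadraticDatum
open Summit.HodgeConjecture.HodgeConjecture.Cruxes.H413.F0P3cDyRamDiagonalTorusDefs
open Summit.HodgeConjecture.HodgeConjecture.Cruxes.H413.F0P3cDyRamDiagonalStrataDefs
open Summit.HodgeConjecture.HodgeConjecture.Cruxes.H413.F0P3cDyRamDiagonalGluedStabiliserIndex (ne_zero_and_v_lt_one_of_v_eq_exp)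
open Summit.HodgeConjecture.HodgeConjecture.Cruxes.H413.F0P3cDyRamDiagonalGluedStratumTwo
open Summit.HodgeConjecture.HodgeConjecture.Cruxes.H413.F0P3cDyRamDiagonalGluedTubeCriterionTypeTwo (isTypeTwoPolarisable_latt_hnf_glued_iff)
open Summit.HodgeConjecture.HodgeConjecture.Cruxes.H413.F0P3cDyRamDiagonalGluedPolarisationCountTypeTwo (polarisationCount_latt_glued_typeTwo_eq_pow)
open Summit.HodgeConjecture.HodgeConjecture.Cruxes.H413.F0P3cDyRamDiagonalGluedZeroPolarisationCountTypeTwo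
open Summit.HodgeConjecture.HodgeConjecture.Cruxes.H413.F0P3cDyRamDiagonalGluedSocketTwo
open scoped Valued WithZero Matrix MatrixGroups

section Multiplicity

variable {K : Type*} [Field K] [Valued K ℤᵐ⁰]

/-- **THE POLARISATION COUNT IS THE PER-STRATUM CONSTANT** on `stratumTwo (2ρ+1, 2ρ+1+s, 2ρ+1+s)`: `q − 1` at `ρ = 0` (★ G2-C2), `q^{1−ρ%2}` at `ρ ≥ 1` (★ G2-B), read through ★ F1₂ and
★ p856270. [cite: Kottwitz1986BaseChangeUnits, §1 pp. 240–241] [cite: Jacobowitz1962, §7–§8] -/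
theorem polarisationCount_eq_of_mem_stratumTwo_G1 {σ : K →+* K} (hσ : ∀ a, σ (σ a) = a) (hvσ : ∀ a, Valued.v (σ a) = Valued.v a)
    (hfix : ∀ x : K, σ x = x → x ≠ 0 → ∃ n : ℤ, Valued.v x = WithZero.exp (2 * n)) {ϖ : K} (hϖ : Valued.v ϖ = WithZero.exp (-1 : ℤ))
    {d : ℕ} (hd : Valued.v (ϖ - σ ϖ) = Valued.v ϖ ^ d) [Finite 𝓀[K]] (hTr : ∀ a : K, Valued.v (a + σ a) ≤ Valued.v ϖ * Valued.v a)
    (T : GL (Fin 3) K) (ρ s : ℕ) (hs : 1 ≤ s) {M : Submodule 𝒪[K] (Fin 3 → K)} (hM : M ∈ stratumTwo σ ϖ T ![2 * ρ + 1, 2 * ρ + 1 + s, 2 * ρ + 1 + s]) :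
    (polarisationCount σ ϖ 2 M : ℚ) = if ρ = 0 then (Nat.card 𝓀[K] : ℚ) - 1 else (Nat.card 𝓀[K] : ℚ) ^ (1 - ρ % 2) := by
  obtain ⟨hϖ0, hϖ1⟩ := ne_zero_and_v_lt_one_of_v_eq_exp hϖ
  have hs2 : 2 ∣ s := (two_dvd_of_mem_stratumTwo_G1 hvσ hfix hϖ T hs hM).1
  rcases Nat.eq_zero_or_pos ρ with rfl | hρ
  · -- ρ = 0: root-glued frame, `q − 1` classes
    rw [if_pos rfl]
    rw [stratumTwo_G1_zero_eq hvσ hfix hϖ T hs] at hM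
    obtain ⟨y, ζ, hζ, hy, rfl, -, -⟩ := hM
    simp only [Nat.mul_zero, Nat.zero_add] at *
    have hdet : (!![1, 0, 0; 0, 1, 0; y, ζ, ϖ ^ (1 + s)] : Matrix (Fin 3) (Fin 3) K).det ≠ 0 := by
      rw [Matrix.det_fin_three]; simp [hϖ0]
    have h := polarisationCount_latt_glued_zero_typeTwo_eq hσ hvσ hfix hϖ hd s hs2 hs hζ hy (Matrix.GeneralLinearGroup.mkOfDetNeZero _ hdet) rfl
    have hq : 1 ≤ Nat.card 𝓀[K] := Nat.one_le_iff_ne_zero.2 Nat.card_pos.ne'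
    rw [show polarisationCount σ ϖ 2 (latt (!![1, 0, 0; 0, 1, 0; y, ζ, ϖ ^ (1 + s)] : Matrix (Fin 3) (Fin 3) K)) = Nat.card 𝓀[K] - 1 from h,
      Nat.cast_sub hq, Nat.cast_one]
  · -- ρ ≥ 1: glued frame, `q^{1−ρ%2}` classes
    rw [if_neg (by omega)]
    rw [stratumTwo_G1_eq hvσ hfix hϖ T hρ hs] at hM
    obtain ⟨x, ζ, y'', hx, hζ, hy'', rfl, -, hpol⟩ := hM
    have hdet : (!![1, 0, 0; x, ϖ ^ ρ, 0; x * ζ + y'', ϖ ^ ρ * ζ, ϖ ^ (2 * ρ + 1 + s)] : Matrix (Fin 3) (Fin 3) K).det ≠ 0 := by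
      rw [Matrix.det_fin_three]; simp [hϖ0]
    obtain ⟨f₀, hf₀, hR₀⟩ := (isTypeTwoPolarisable_latt_hnf_glued_iff hσ hvσ hϖ0 hϖ1 hTr ρ s hρ hs2 hs hx hζ hy''
      (Matrix.GeneralLinearGroup.mkOfDetNeZero _ hdet) rfl).1 hpol
    have h := polarisationCount_latt_glued_typeTwo_eq_pow hσ hvσ hfix hϖ hd hTr hρ s hs2 hs hx hζ hy'' (Matrix.GeneralLinearGroup.mkOfDetNeZero _ hdet) rfl hf₀ hR₀
    rw [show polarisationCount σ ϖ 2 (latt (!![1, 0, 0; x, ϖ ^ ρ, 0; x * ζ + y'', ϖ ^ ρ * ζ, ϖ ^ (2 * ρ + 1 + s)] : Matrix (Fin 3) (Fin 3) K)) =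
      Nat.card 𝓀[K] ^ (1 - ρ % 2) from h, Nat.cast_pow]

end Multiplicity

section Socket

variable {K : Type} [Field K] [Valued K ℤᵐ⁰] [Fintype 𝓀[K]] {σ : K →+* K} {ϖ : K} {d t : ℕ} {α β : K} {N₀ n₁ n₂ n₃ : ℕ} {T : GL (Fin 3) K}

/-- **SOCKET `stub_B56_G1` OF SKELETON₂ v2 (reading (iii), multiplicity-weighted), BINDER FOR BINDER** — glued ∕ root-glued type-2 strata, axis `(2ρ+1, 2ρ+1+s, 2ρ+1+s)`, `ρ ≥ 0`,
`s ≥ 1`: TUBE `(q−1)·q^{2ρ+s∕2}` iff `s` even, `2ρ+1 ≤ min(n₂,n₃)`, `2ρ+1+s ≤ n₁`; GLUE `q^{2ρ+1+s∕2−⌈(2ρ+1−n₂)∕2⌉}` iff `s` even, `n₂ = n₃`, `n₁ = n₂+s`, `n₂ < 2ρ+1 ≤ 2n₂`,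
`2ρ+1−n₂ ≤ n₂−d+1`. [cite: Kottwitz1986BaseChangeUnits, §1 pp. 240–241] [cite: Rogawski1990, §4.9 Prop. 4.9.1 (a) p. 55] -/
theorem finsum_polarisationCount_mul_stabiliserWeight_stratumTwo_G1 (hD : IsRamifiedQuadraticDatum σ ϖ d t) (h2 : Valued.v (2 : K) < 1)
    (hE : IsElementDatum σ ϖ N₀ α β n₁ n₂ n₃) (hN₀ : d ≤ N₀) (hT : (T : Matrix (Fin 3) (Fin 3) K) = Matrix.diagonal ![α, β, 1]) (ρ s : ℕ) (hs : 1 ≤ s) :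
    ∑ᶠ M ∈ stratumTwo σ ϖ T ![2 * ρ + 1, 2 * ρ + 1 + s, 2 * ρ + 1 + s], (polarisationCount σ ϖ 2 M : ℚ) * stabiliserWeight σ M =
      (if 2 ∣ s ∧ 2 * ρ + 1 ≤ min n₂ n₃ ∧ 2 * ρ + 1 + s ≤ n₁ then (((Fintype.card 𝓀[K] : ℚ) - 1) * (Fintype.card 𝓀[K] : ℚ) ^ (2 * ρ + s / 2)) else 0) +
      (if 2 ∣ s ∧ n₂ = n₃ ∧ n₁ = n₂ + s ∧ n₂ < 2 * ρ + 1 ∧ 2 * ρ + 1 ≤ 2 * n₂ ∧ 2 * ρ + 1 - n₂ ≤ n₂ - d + 1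
        then ((Fintype.card 𝓀[K] : ℚ) ^ (2 * ρ + 1 + s / 2 - (2 * ρ + 1 - n₂ + 1) / 2)) else 0) := by
  have hTr := trace_bound_of_isRamifiedQuadraticDatum hD h2
  refine finsum_polarisationCount_mul_stabiliserWeight_stratumTwo_G1_of_mult hD h2 hE hN₀ hT ρ s hs fun M hM => ?_
  obtain ⟨hσ, hvσ, hϖ, hfix, hd, -, -⟩ := hD
  rw [← Nat.card_eq_fintype_card]
  exact polarisationCount_eq_of_mem_stratumTwo_G1 hσ hvσ hfix hϖ hd hTr T ρ s hs hM

end Socket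

end Summit.HodgeConjecture.HodgeConjecture.Cruxes.H413.F0P3cDyRamDiagonalGluedSocketTwoStub

end
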